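import Mathlib
import Summits.AnomalousDissipation.AnomalousDissipation.Theorems.SolenoidalFractalHomogenisationLagrangianStepW7Assembly
import HarnessLib

/-!
# K1L_D (stmt-AnomalousDissipation-27980), registry v9 — W7 pieces 2 and 3 BY NAME: `stub_compactRange` (L) and `stub_largeR` (XL)

Both registered stubs of the W7 re-cut (`HOME/ad-ideate-p1/r25/v9/onelevel_design_v9.lean`, texts byte-identical since v5/v8) follow from
ONE theorem, `W7Cell.classDecayW_cubature_all` (`ClassDecayW cubatureWord M hM lo hi Λ β 1 Kb e cK admAll`, explicit `cK > 0`), by the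
monotonicity `classDecayW_mono` in the admissibility predicate (`admCompact R₁`, `admLarge R₁` are both weaker than `admAll`).
The engine: weak-solution mode calculus S1a (prover ad-k1l-cellLawV-w1 g4, 13 `CellChain*` files), three-mode hypocoercivity functional
(planner ad-ideate-p4 g13) on the abstract slot step (`W7Slot.slot_step`, S1b), scalar spine and period bricks (planner ad-ideate-p5 g10,
`W7Engine.*`), coverage `HighLabelDecay.coupledUnshielded_quant` (p5 g9 / k3l g5), assembly `W7Cell.*` (prover ad-sawtooth-k1loc-p1 g11).
`ν₀ = 1`, `CK = e`, `R₁ = 1`.  No sorry.  NOT a proof of the crux `LagrangianRenormalisationStepDesign` by itself (the other registered stubs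
remain) nor of anomalous dissipation; rung F-D1.A0. [cite: BedrossianCotiZelati2017, Thm 1.1 (enhanced dissipation; here: ν-uniform Bloch-chain rate)] [problem: turb]
-/

set_option linter.dupNamespace false

namespace Summit.AnomalousDissipation.AnomalousDissipation.Theorems.SolenoidalFractalHomogenisation.LagrangianStep

/-- **W7 piece 2 (L) — COMPACT LABEL RANGE** `r ∈ [1/Kb, R₁]`, every `R₁ ≥ 1` (registered text of `stub_compactRange`, registry v9):
from `W7Cell.classDecayW_cubature_all` by `classDecayW_mono` (`ν₀ = 1`, `CK = e`). [cite: BedrossianCotiZelati2017, Thm 1.1] -/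
theorem stub_compactRange (M : ℝ) (hM : 0 < M) (lo hi Λ β : ℝ) (hlo : 0 < lo) (hlo1 : lo ≤ 1) (hhi : 1 ≤ hi) (hΛ : 1 < Λ)
    (hβ : 0 ≤ β) (Kb : ℝ) (hKb : 1 ≤ Kb) (R₁ : ℝ) (hR₁ : 1 ≤ R₁) :
    ∃ CK : ℝ, 1 ≤ CK ∧ ∃ cK > (0:ℝ), ∃ ν₀ > (0:ℝ),
      ClassDecayW Summit.AnomalousDissipation.AnomalousDissipation.Theorems.cubatureWord M hM lo hi Λ β ν₀ Kb CK cK (admCompact R₁) := by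
  have _hR := hR₁
  obtain ⟨cK, hcK, h⟩ := W7Cell.classDecayW_cubature_all M hM hlo hlo1 hhi hΛ hβ hKb
  exact ⟨Real.exp 1, Real.one_le_exp (by norm_num), cK, hcK, 1, one_pos,
    classDecayW_mono le_rfl le_rfl le_rfl (Real.exp_pos 1).le (fun _ _ _ _ => trivial) h⟩

/-- **W7 piece 3 (XL) — LARGE LABEL RATIO** `r ≥ R₁` for ONE `R₁ ≥ 1` (registered text of `stub_largeR`, registry v9): from
`W7Cell.classDecayW_cubature_all` by `classDecayW_mono` (`R₁ = 1`, `ν₀ = 1`, `CK = e`). [cite: BedrossianCotiZelati2017, Thm 1.1] -/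
theorem stub_largeR (M : ℝ) (hM : 0 < M) (lo hi Λ β : ℝ) (hlo : 0 < lo) (hlo1 : lo ≤ 1) (hhi : 1 ≤ hi) (hΛ : 1 < Λ)
    (hβ : 0 ≤ β) (Kb : ℝ) (hKb : 1 ≤ Kb) :
    ∃ R₁ : ℝ, 1 ≤ R₁ ∧ ∃ CK : ℝ, 1 ≤ CK ∧ ∃ cK > (0:ℝ), ∃ ν₀ > (0:ℝ),
      ClassDecayW Summit.AnomalousDissipation.AnomalousDissipation.Theorems.cubatureWord M hM lo hi Λ β ν₀ Kb CK cK (admLarge R₁) := by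
  obtain ⟨cK, hcK, h⟩ := W7Cell.classDecayW_cubature_all M hM hlo hlo1 hhi hΛ hβ hKb
  exact ⟨1, le_rfl, Real.exp 1, Real.one_le_exp (by norm_num), cK, hcK, 1, one_pos,
    classDecayW_mono le_rfl le_rfl le_rfl (Real.exp_pos 1).le (fun _ _ _ _ => trivial) h⟩

end Summit.AnomalousDissipation.AnomalousDissipation.Theorems.SolenoidalFractalHomogenisation.LagrangianStep
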